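import Literature.NumberTheory.GelbartRogawski1991.DoubledUnitaryGlobalSplittingData    -- ★ `Fp`, `UnitaryGroup.adelic`, `conjAdele`
import Literature.NumberTheory.Automorphic.AdelicVectorHeightBound                        -- ★ `matHeightBound`, `vecHeight_vecMul_le`
import Literature.NumberTheory.Automorphic.AdelicVectorHeightGalois                       -- ★ `vecHeight_galSmul`, `isHeightFinite_galSmul_iff`
import Summits.HodgeConjecture.HodgeConjecture.Theorems.K2LiuPluckerMinors                -- ★ F1 §3 `coe_inv_apply_of_unitary_diagonal`
import Summits.HodgeConjecture.HodgeConjecture.Theorems.K2LiuVecHeightOuter               -- ★ F2 `vecHeight_outer`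
import HarnessLib

/-!
# Crux `HLiu418`, Track B road `K2_Liu`, unit U5 «DOUBLING ZETA», socket #16a (organ (IV-c)) — helper «F5»:
# on `U(diag d)(𝔸)` the height of `(1, g, g⁻¹)` is at most a constant times the SQUARE of the height of `(1, g)`

Cell `hodgecm-mathlib`, crux item hLiu418 = `stmt-HodgeConjecture-24832`, route of record `HCCMUnconditional`; squad K2 ∕ K2Liu, prover K2Liu-p04 (g0)
(socket #16a `sig_K2LiuDoublingHeightDecayPointwise`, U5 ED. 5 652390c11702f8de :235; plan of record K2/STATUS 21:43Z, file (F5)).  THEOREMS ONLY (no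
`def`, no instance, no notation, no named-fact hypothesis, no `sorry`); lane `--supports stmt-HodgeConjecture-24832 --as helper` (count-neutral).

WHY.  The Borel–Jacquet height `‖g‖` (★ `adelicHeightGL`) of `g ∈ U(V)(𝔸) ≤ GL_N(𝔸_L)`, `V = diag(d)`, is built from the entries of `g` AND of `g⁻¹`,
whereas the Plücker vector of `ι(g, 1)` only sees the entries of `g` (★ F4).  For UNITARY `g` the inverse is `g⁻¹ = D⁻¹ ḡᵀ D` (★ F1 §3:
`(g⁻¹)ᵢₖ = dᵢ⁻¹ · σ(gₖᵢ) · dₖ`, `σ = c ⊗ 1` the conjugation of `𝔸_L`), so with the vectors `x_g = (1, (gᵢⱼ))` and `y_g = (1, (gᵢⱼ), ((g⁻¹)ᵢₖ))`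
every coordinate of `y_g` is a rational multiple of a coordinate of the OUTER PRODUCT `x_g ⊗ (σ • x_g)` (the coordinate `1` of `x_g` makes both
`x_g` and `σ • x_g` appear in it): `y_g = (x_g ⊗ σ • x_g) · M` for a fixed matrix `M` of rational constants.  Hence, by ★ `vecHeight_vecMul_le`
(`h(z M) ≤ H(M) h(z)`), ★ F2 `vecHeight_outer` (`h(x ⊗ x′) = h(x) h(x′)`) and Galois invariance ★ `vecHeight_galSmul` (`h(σ • x) = h(x)`):

* `isHeightFinite_of_apply_eq_one` — a vector with a coordinate `1` has finite height data;
* `vecMul_transfer_eq` — the identity `y_g = (x_g ⊗ σ • x_g) · M`;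
* **`vecHeight_one_entries_inv_le`** — `h(y_g) ≤ H(M) · h(x_g)²` for every `g ∈ U(diag d)(𝔸)` (`dᵢ ≠ 0`), `M` independent of `g`
  ([BorelJacquet1979, §1.2 (properties of `‖·‖`)]; [Rogawski1990, §1.9 p. 8 (`g⁻¹ = Φ⁻¹ ᵗḡ Φ`)]).

HONEST LABEL.  Count-neutral helper; `HC_CM` is proved only modulo the 7 printed citations (2 remaining named inputs: hLiu418 =
`stmt-HodgeConjecture-24832`, h413 = `stmt-HodgeConjecture-24833`) until rung 0 closes.
-/

set_option autoImplicit false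
-- the mandated namespace repeats the single-problem summit's segment (`HodgeConjecture.HodgeConjecture`)
set_option linter.dupNamespace false

noncomputable section

open scoped NNReal Matrix
open NumberField IsDedekindDomain

namespace Summit.HodgeConjecture.HodgeConjecture.Cruxes.HLiu418.K2LiuUnitaryInverseHeight

open Literature.NumberTheory.Automorphic Literature.NumberTheory.Automorphic.UnitaryGroup
open Literature.NumberTheory.GelbartRogawski1991 Literature.NumberTheory.GelbartRogawski1991.GRConstruction
open Summit.HodgeConjecture.HodgeConjecture.Cruxes.HLiu418.K2LiuPluckerMinors
open Summit.HodgeConjecture.HodgeConjecture.Cruxes.HLiu418.K2LiuVecHeightOuter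

/-! ## §1 Vectors with a coordinate `1` have finite height data -/

/-- A vector of adeles one of whose coordinates is `1` has finite height data: its finite local heights are `≥ 1` everywhere and `≤ 1` at
almost every place (every adele is integral almost everywhere). [cite: Garrett2018, §2.2 (PDF p. 82)] -/
theorem isHeightFinite_of_apply_eq_one {K : Type} [Field K] [NumberField K] {ι : Type*} [Fintype ι] {x : ι → AdeleRing (𝓞 K) K}
    (i₀ : ι) (h1 : x i₀ = 1) : IsHeightFinite K x := by
  have hint : ∀ᶠ v : HeightOneSpectrum (𝓞 K) in Filter.cofinite, ∀ i : ι, (x i).2 v ∈ v.adicCompletionIntegers K :=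
    Filter.eventually_all.2 fun i => (x i).2.2
  refine (Filter.eventually_cofinite.1 hint).subset fun v hv => ?_
  intro hall
  apply hv
  refine le_antisymm (Finset.sup_le fun i _ => ?_) ?_
  · rw [← NNReal.coe_le_coe, coe_nnnorm, NNReal.coe_one]
    exact Valued.toNormedField.norm_le_one_iff.2 (hall i)
  · have h := nnnorm_snd_apply_le_vecFinHeight v x i₀
    rw [h1, show ((1 : AdeleRing (𝓞 K) K).2 v) = 1 from rfl, nnnorm_one] at h
    exact h

/-! ## §2 The transfer identity `(1, g, g⁻¹) = ((1, g) ⊗ σ • (1, g)) · M` on `U(diag d)(𝔸)` -/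

variable (L : Type) [Field L] [NumberField L] [IsCMField L] {N : ℕ} (dV : Fin N → L)

/-- **`(g⁻¹)ᵢₖ = dᵢ⁻¹ · σ(gₖᵢ) · dₖ` on `U(diag d)(𝔸)`** (`σ = c ⊗ 1`; ★ F1 §3 at the adelic diagonal form). [cite: Rogawski1990, §1.9 p. 8] -/
theorem coe_inv_apply (hdV0 : ∀ i, dV i ≠ 0) (g : UnitaryGroup.adelic (Fp L) L (IsCMField.complexConj L) N (Matrix.diagonal dV))
    (i k : Fin N) :
    (((g⁻¹ : UnitaryGroup.adelic (Fp L) L (IsCMField.complexConj L) N (Matrix.diagonal dV)) : GL (Fin N) (AdeleRing (𝓞 L) L)) :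
        Matrix (Fin N) (Fin N) (AdeleRing (𝓞 L) L)) i k =
      algebraMap L (AdeleRing (𝓞 L) L) (dV i)⁻¹ *
        (IsCMField.complexConj L • ((g : GL (Fin N) (AdeleRing (𝓞 L) L)) : Matrix (Fin N) (Fin N) (AdeleRing (𝓞 L) L)) k i) *
          algebraMap L (AdeleRing (𝓞 L) L) (dV k) := by
  have hg : (((g : GL (Fin N) (AdeleRing (𝓞 L) L)) : Matrix (Fin N) (Fin N) (AdeleRing (𝓞 L) L)).map
        (conjAdele (Fp L) L (IsCMField.complexConj L)))ᵀ * Matrix.diagonal (fun i => algebraMap L (AdeleRing (𝓞 L) L) (dV i)) *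
        ((g : GL (Fin N) (AdeleRing (𝓞 L) L)) : Matrix (Fin N) (Fin N) (AdeleRing (𝓞 L) L)) =
      Matrix.diagonal (fun i => algebraMap L (AdeleRing (𝓞 L) L) (dV i)) := by
    have h : (((g : GL (Fin N) (AdeleRing (𝓞 L) L)) : Matrix (Fin N) (Fin N) (AdeleRing (𝓞 L) L)).map
          (conjAdele (Fp L) L (IsCMField.complexConj L)))ᵀ * UnitaryGroup.adelicForm L N (Matrix.diagonal dV) *
          ((g : GL (Fin N) (AdeleRing (𝓞 L) L)) : Matrix (Fin N) (Fin N) (AdeleRing (𝓞 L) L)) =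
        UnitaryGroup.adelicForm L N (Matrix.diagonal dV) :=
      (mem_unitaryGroupOfForm_iff).1 g.2
    have hform : UnitaryGroup.adelicForm L N (Matrix.diagonal dV) =
        Matrix.diagonal (fun i => algebraMap L (AdeleRing (𝓞 L) L) (dV i)) := by
      rw [UnitaryGroup.adelicForm, Matrix.diagonal_map (map_zero _)]
    rwa [hform] at h
  have hd : ∀ i, algebraMap L (AdeleRing (𝓞 L) L) (dV i)⁻¹ * algebraMap L (AdeleRing (𝓞 L) L) (dV i) = 1 := fun i => by
    rw [← map_mul, inv_mul_cancel₀ (hdV0 i), map_one]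
  rw [Subgroup.coe_inv, coe_inv_apply_of_unitary_diagonal hd hg i k]
  rfl

/-- **The transfer identity**: every coordinate of `y_g = (1, g, g⁻¹)` is a rational constant times a coordinate of `x_g ⊗ σ • x_g`,
`x_g = (1, g)` — written as `y_g = (x_g ⊗ σ • x_g) · M` with the constant matrix `M` (entries `0`, `1`, `dᵢ⁻¹ dₖ`).
[cite: BorelJacquet1979, §1.2] -/
theorem vecMul_transfer_eq (hdV0 : ∀ i, dV i ≠ 0) (g : UnitaryGroup.adelic (Fp L) L (IsCMField.complexConj L) N (Matrix.diagonal dV)) :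
    (Sum.elim (fun o : Option (Fin N × Fin N) => o.elim 1 fun ij => ((g : GL (Fin N) (AdeleRing (𝓞 L) L)) :
          Matrix (Fin N) (Fin N) (AdeleRing (𝓞 L) L)) ij.1 ij.2)
        (fun ik : Fin N × Fin N => (((g⁻¹ : UnitaryGroup.adelic (Fp L) L (IsCMField.complexConj L) N (Matrix.diagonal dV)) :
          GL (Fin N) (AdeleRing (𝓞 L) L)) : Matrix (Fin N) (Fin N) (AdeleRing (𝓞 L) L)) ik.1 ik.2) :
        Option (Fin N × Fin N) ⊕ (Fin N × Fin N) → AdeleRing (𝓞 L) L) =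
      (fun p : Option (Fin N × Fin N) × Option (Fin N × Fin N) =>
          (fun o : Option (Fin N × Fin N) => o.elim 1 fun ij => ((g : GL (Fin N) (AdeleRing (𝓞 L) L)) :
            Matrix (Fin N) (Fin N) (AdeleRing (𝓞 L) L)) ij.1 ij.2) p.1 *
          (IsCMField.complexConj L • fun o : Option (Fin N × Fin N) => o.elim 1 fun ij => ((g : GL (Fin N) (AdeleRing (𝓞 L) L)) :
            Matrix (Fin N) (Fin N) (AdeleRing (𝓞 L) L)) ij.1 ij.2) p.2) ᵥ*
        (Matrix.of fun (r : Option (Fin N × Fin N) × Option (Fin N × Fin N)) (col : Option (Fin N × Fin N) ⊕ (Fin N × Fin N)) =>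
          Sum.elim (fun a : Option (Fin N × Fin N) => if r = (a, none) then (1 : AdeleRing (𝓞 L) L) else 0)
            (fun ik : Fin N × Fin N => if r = (none, some (ik.2, ik.1)) then
              algebraMap L (AdeleRing (𝓞 L) L) ((dV ik.1)⁻¹ * dV ik.2) else 0) col) := by
  funext col
  rw [Matrix.vecMul, dotProduct]
  rcases col with a | ⟨i, k⟩
  · simp only [Sum.elim_inl, Matrix.of_apply, mul_ite, mul_one, mul_zero, Finset.sum_ite_eq', Finset.mem_univ, if_true,
      Pi.smul_apply, Option.elim, smul_one]
  · simp only [Sum.elim_inr, Matrix.of_apply, mul_ite, mul_zero, Finset.sum_ite_eq', Finset.mem_univ, if_true, Pi.smul_apply,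
      Option.elim, one_mul, map_mul]
    rw [coe_inv_apply L dV hdV0 g i k]
    ring

/-! ## §3 `h(1, g, g⁻¹) ≤ C · h(1, g)²` -/

/-- **THE INVERSE-HEIGHT BOUND ON `U(diag d)(𝔸)`.**  There is a constant `C` (the height bound ★ `matHeightBound` of the transfer matrix; it depends
on `d` only) such that for every `g ∈ U(diag d)(𝔸)`: `h_L(1, (gᵢⱼ), ((g⁻¹)ᵢₖ)) ≤ C · h_L(1, (gᵢⱼ))²`.  Ingredients: §2, ★ `vecHeight_vecMul_le`, ★ F2
`vecHeight_outer`, ★ `vecHeight_galSmul`. [cite: BorelJacquet1979, §1.2] [cite: Rogawski1990, §1.9 p. 8] -/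
theorem vecHeight_one_entries_inv_le (hdV0 : ∀ i, dV i ≠ 0) :
    ∃ C : ℝ≥0, ∀ g : UnitaryGroup.adelic (Fp L) L (IsCMField.complexConj L) N (Matrix.diagonal dV),
      vecHeight L (Sum.elim (fun o : Option (Fin N × Fin N) => o.elim 1 fun ij => ((g : GL (Fin N) (AdeleRing (𝓞 L) L)) :
            Matrix (Fin N) (Fin N) (AdeleRing (𝓞 L) L)) ij.1 ij.2)
          (fun ik : Fin N × Fin N => (((g⁻¹ : UnitaryGroup.adelic (Fp L) L (IsCMField.complexConj L) N (Matrix.diagonal dV)) :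
            GL (Fin N) (AdeleRing (𝓞 L) L)) : Matrix (Fin N) (Fin N) (AdeleRing (𝓞 L) L)) ik.1 ik.2) :
          Option (Fin N × Fin N) ⊕ (Fin N × Fin N) → AdeleRing (𝓞 L) L) ≤
        C * vecHeight L (fun o : Option (Fin N × Fin N) => o.elim 1 fun ij => ((g : GL (Fin N) (AdeleRing (𝓞 L) L)) :
            Matrix (Fin N) (Fin N) (AdeleRing (𝓞 L) L)) ij.1 ij.2) ^ 2 := by
  refine ⟨matHeightBound L (Matrix.of fun (r : Option (Fin N × Fin N) × Option (Fin N × Fin N))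
      (col : Option (Fin N × Fin N) ⊕ (Fin N × Fin N)) =>
        Sum.elim (fun a : Option (Fin N × Fin N) => if r = (a, none) then (1 : AdeleRing (𝓞 L) L) else 0)
          (fun ik : Fin N × Fin N => if r = (none, some (ik.2, ik.1)) then
            algebraMap L (AdeleRing (𝓞 L) L) ((dV ik.1)⁻¹ * dV ik.2) else 0) col), fun g => ?_⟩
  set x : Option (Fin N × Fin N) → AdeleRing (𝓞 L) L := fun o => o.elim 1 fun ij =>
    ((g : GL (Fin N) (AdeleRing (𝓞 L) L)) : Matrix (Fin N) (Fin N) (AdeleRing (𝓞 L) L)) ij.1 ij.2 with hx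
  have hxfin : IsHeightFinite L x := isHeightFinite_of_apply_eq_one none rfl
  have hσxfin : IsHeightFinite L (IsCMField.complexConj L • x) := (isHeightFinite_galSmul_iff _ x).2 hxfin
  have hzfin : IsHeightFinite L (fun p : Option (Fin N × Fin N) × Option (Fin N × Fin N) => x p.1 * (IsCMField.complexConj L • x) p.2) :=
    isHeightFinite_outer hxfin hσxfin
  have hyfin : IsHeightFinite L (Sum.elim x (fun ik : Fin N × Fin N =>
      (((g⁻¹ : UnitaryGroup.adelic (Fp L) L (IsCMField.complexConj L) N (Matrix.diagonal dV)) : GL (Fin N) (AdeleRing (𝓞 L) L)) :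
        Matrix (Fin N) (Fin N) (AdeleRing (𝓞 L) L)) ik.1 ik.2) : Option (Fin N × Fin N) ⊕ (Fin N × Fin N) → AdeleRing (𝓞 L) L) :=
    isHeightFinite_of_apply_eq_one (Sum.inl none) rfl
  have htransfer := vecMul_transfer_eq L dV hdV0 g
  rw [htransfer] at hyfin ⊢
  refine (vecHeight_vecMul_le hzfin hyfin).trans ?_
  rw [vecHeight_outer hxfin hσxfin, vecHeight_galSmul, sq]

end Summit.HodgeConjecture.HodgeConjecture.Cruxes.HLiu418.K2LiuUnitaryInverseHeight

end
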